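import Mathlib.Combinatorics.SetFamily.Shadow
import Mathlib.Data.Nat.Choose.Sum
import Mathlib.Data.Finset.Powerset
import Mathlib.Data.Finset.Sym
import Mathlib.Algebra.BigOperators.Ring.Finset
import Mathlib.Algebra.Order.BigOperators.Group.Finset
import Mathlib.Data.Real.Basic
import Mathlib.Tactic.Linarith
import Mathlib.Tactic.FieldSimp
import Mathlib.Tactic.Positivity
import Mathlib.Tactic.Ring
import HarnessLib

/-!
# The hypergraph container theorem (Bernshteyn–Delcourt–Towsner–Tserunyan's proof), fully proved

The container theorem of Balogh–Morris–Samotij (JAMS 2015) and Saxton–Thomason (Invent. 2015) in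
the form and with the four-page non-algorithmic proof of Bernshteyn–Delcourt–Towsner–Tserunyan
(Proc. AMS 147 (2019), arXiv:1801.07186, Theorem 8 and §5), for a `k`-uniform hypergraph given as
a finite family `H : Finset (Finset α)` of `k`-subsets of a ground finset `X`
(`H ⊆ X.powersetCard k`). Everything here is a theorem (no named facts); it is the container step
of the formalisation of the Rödl–Ruciński / Nenadov–Steger random Ramsey 1-statement
(`Literature.Probability.RandomGraphs.RodlRucinski1995_oneStatement`).

## Vocabulary (BDTT §2–3)

* `hdeg H u` — the co-degree `deg_H(u) = |{e ∈ H : u ⊆ e}|` (BDTT Notation 2, `|H_u|`).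
* `fiber H F` — the fibre `H_F = {e ∖ {f} : e ∈ H, f ∈ F ∩ e}` over a vertex set `F`.
* `IsIndep H I` — no edge of `H` inside `I`.
* `IsBounded H k D` — MULTIPLICATIVE form of BDTT's "`δ`-bounded" (Def. 4): `deg_H(u) ≤ D^{k-|u|}`
  for `1 ≤ |u| ≤ k-1`, where `D = |X|^δ`.
* `IsContainerPair X H m Φ β print cont` — a print/container pair (Def. 5, 7) in functional form:
  `m` fingerprints `print I i ⊆ I` of size `≤ Φ` for each independent `I ⊆ X`, a container
  `cont P ⊆ X` determined by the fingerprints alone, `I ⊆ ⋃ᵢ print I i ∪ cont (print I)` and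
  `|X ∖ cont (print I)| ≥ β`.

## The theorem (`container_theorem`), multiplicative reparametrisation

With `N = |X|`, `D = N^δ`, `η = N^{-ε}`: if `deg_H(u) ≤ D^{k-|u|}` (`1 ≤ |u| ≤ k-1`),
`|H| ≥ η N D^{k-1}`, `0 < η ≤ 2^{-2k}` (BDTT: `ε ≥ 2k log_N 2`) and `N/D ≥ 2^{k-1}`
(`π ≥ (k-1) log_N 2`), then there is a print/container pair with `k-1` fingerprints of size
`≤ N/D` (`π = 1-δ`) and containers with `|X ∖ C| ≥ η^{3^{k-1}} N` (`σ = 3^{k-1} ε`).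
The proof is BDTT's induction on `k` (§5) with the constants of §5.1 in multiplicative form:
`D' = 2D`, `η' = η² 2^{-2k}`, `Φ̃ = η 2^{-k} N/D`, `η̃ = η 2^{-(k+1)}`; the two kinds of removed
edges in BDTT's `Ĥ` (eq. (5.2)) are unified as "`e` contains a set `u`, `1 ≤ |u| ≤ k-1`, with
`deg_{H_F}(u) ≥ D^{k-1-|u|}`" (for `|u| = k-1` this says `u ∈ H_F`). Lemma-by-lemma:
`card_le_card_hminus_add` = Claims 20–22, `le_card_sdiff_cset` = §5.7,
`expanding_of_expansive` = Claim 15, `expansive_insert` = Claim 19 + §5.6,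
`step_isContainerPair` = §5.2–5.6 assembled, `base_isContainerPair` = the base case `k = 1`.

## References

* A. Bernshteyn, M. Delcourt, H. Towsner, A. Tserunyan, *A short nonalgorithmic proof of the
  containers theorem for hypergraphs*, Proc. Amer. Math. Soc. 147 (2019) 1739–1749, Theorem 8, §5.
  arXiv:1801.07186 (held, read in full). [BernshteynEtAl2019]
* J. Balogh, R. Morris, W. Samotij, *The method of hypergraph containers*, Proc. ICM 2018, §3
  (the hypergraph container lemma; statement only). arXiv:1801.04584 (held).
  [BaloghMorrisSamotij2019]
-/

namespace Literature.Combinatorics.Hypergraph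

open Finset

variable {α : Type*}

/-! ### Independent sets -/

/-- `I` is `H`-independent: no member of `H` lies inside `I` (BDTT §2: `H ∩ [I]^k = ∅`).
[cite: BernshteynEtAl2019, §2] -/
def IsIndep (H : Finset (Finset α)) (I : Finset α) : Prop := ∀ e ∈ H, ¬ e ⊆ I

/-- Independence is antitone in the family. [folklore] -/
theorem IsIndep.anti {H₁ H₂ : Finset (Finset α)} {I : Finset α} (h : IsIndep H₂ I) (hH : H₁ ⊆ H₂) :
    IsIndep H₁ I := fun e he => h e (hH he)

/-- Independence is antitone in the set. [folklore] -/
theorem IsIndep.subset {H : Finset (Finset α)} {I J : Finset α} (h : IsIndep H I) (hJ : J ⊆ I) :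
    IsIndep H J := fun e he heJ => h e he (heJ.trans hJ)

variable [DecidableEq α]

/-! ### Co-degrees -/

/-- The co-degree `deg_H(u) = |{e ∈ H : u ⊆ e}|` of a vertex set `u` in the set family `H`
(BDTT Notation 2, `deg_H(u) = |H_u|`). [cite: BernshteynEtAl2019, Notation 2] -/
def hdeg (H : Finset (Finset α)) (u : Finset α) : ℕ := #(H.filter fun e => u ⊆ e)

/-- Unfolding of `hdeg`. [folklore] -/
theorem hdeg_def (H : Finset (Finset α)) (u : Finset α) :
    hdeg H u = #(H.filter fun e => u ⊆ e) := rfl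

/-- Co-degrees are monotone in the family. [folklore] -/
theorem hdeg_mono {H₁ H₂ : Finset (Finset α)} (h : H₁ ⊆ H₂) (u : Finset α) :
    hdeg H₁ u ≤ hdeg H₂ u :=
  card_le_card (filter_subset_filter _ h)

/-- Co-degrees are antitone in the set. [folklore] -/
theorem hdeg_anti (H : Finset (Finset α)) {u v : Finset α} (h : u ⊆ v) : hdeg H v ≤ hdeg H u :=
  card_le_card (fun e he => by
    simp only [mem_filter] at he ⊢
    exact ⟨he.1, h.trans he.2⟩)

/-- `deg_{H₁ ∪ H₂}(u) ≤ deg_{H₁}(u) + deg_{H₂}(u)`. [folklore] -/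
theorem hdeg_union_le (H₁ H₂ : Finset (Finset α)) (u : Finset α) :
    hdeg (H₁ ∪ H₂) u ≤ hdeg H₁ u + hdeg H₂ u := by
  rw [hdeg, filter_union]
  exact card_union_le _ _

/-- `deg_H(∅) = |H|`. [folklore] -/
theorem hdeg_empty (H : Finset (Finset α)) : hdeg H ∅ = #H := by
  simp [hdeg]

/-- **Double counting co-degrees of `t`-sets**: if every member of `G` is a `k`-subset of `X`, then
`∑_{u ⊆ X, |u| = t} deg_G(u) = C(k, t) |G|` (each edge is counted once for each of its `t`-subsets;
BDTT proof of Claim 21: "each edge is counted in the degrees of at most `C(k-1, ℓ)` points").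
[cite: BernshteynEtAl2019, Claim 21 (proof)] -/
theorem sum_hdeg_powersetCard {X : Finset α} {G : Finset (Finset α)} {k : ℕ}
    (hG : G ⊆ X.powersetCard k) (t : ℕ) :
    ∑ u ∈ X.powersetCard t, hdeg G u = k.choose t * #G := by
  classical
  have h1 : ∀ u ∈ X.powersetCard t, hdeg G u = ∑ e ∈ G, if u ⊆ e then 1 else 0 := by
    intro u _
    rw [hdeg, card_filter]
  rw [sum_congr rfl h1, sum_comm]
  have h2 : ∀ e ∈ G, (∑ u ∈ X.powersetCard t, if u ⊆ e then 1 else 0) = k.choose t := by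
    intro e he
    have he' := mem_powersetCard.1 (hG he)
    rw [← card_filter]
    have : (X.powersetCard t).filter (fun u => u ⊆ e) = e.powersetCard t := by
      ext u
      simp only [mem_filter, mem_powersetCard]
      constructor
      · rintro ⟨⟨-, hut⟩, hue⟩
        exact ⟨hue, hut⟩
      · rintro ⟨hue, hut⟩
        exact ⟨⟨hue.trans he'.1, hut⟩, hue⟩
    rw [this, card_powersetCard, he'.2]
  rw [sum_congr rfl h2, sum_const, smul_eq_mul, mul_comm]

/-- **Edges meeting a vertex set**: the number of members of `G` that meet `S` is at most
`∑_{x ∈ S} deg_G(x)`. [folklore] -/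
theorem card_filter_meets_le_sum_hdeg (G : Finset (Finset α)) (S : Finset α) :
    #(G.filter fun e => (e ∩ S).Nonempty) ≤ ∑ x ∈ S, hdeg G {x} := by
  classical
  calc #(G.filter fun e => (e ∩ S).Nonempty)
      ≤ #(S.biUnion fun x => G.filter fun e => {x} ⊆ e) := by
        apply card_le_card
        intro e he
        simp only [mem_filter] at he
        obtain ⟨x, hx⟩ := he.2
        simp only [mem_biUnion, mem_filter, singleton_subset_iff]
        exact ⟨x, (mem_inter.1 hx).2, he.1, (mem_inter.1 hx).1⟩
    _ ≤ ∑ x ∈ S, #(G.filter fun e => {x} ⊆ e) := card_biUnion_le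
    _ = ∑ x ∈ S, hdeg G {x} := rfl

/-- If every member of `G` meets `S` then `|G| ≤ ∑_{x ∈ S} deg_G(x)`. [folklore] -/
theorem card_le_sum_hdeg_of_meets (G : Finset (Finset α)) (S : Finset α)
    (h : ∀ e ∈ G, (e ∩ S).Nonempty) : #G ≤ ∑ x ∈ S, hdeg G {x} := by
  have : G.filter (fun e => (e ∩ S).Nonempty) = G := filter_true_of_mem h
  have h2 := card_filter_meets_le_sum_hdeg G S
  rwa [this] at h2

/-- **Edges containing a member of a family**: the number of members of `H` containing some member
of `V` is at most `∑_{v ∈ V} deg_H(v)`. [folklore] -/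
theorem card_filter_exists_subset_le_sum_hdeg (H : Finset (Finset α)) (V : Finset (Finset α)) :
    #(H.filter fun e => ∃ v ∈ V, v ⊆ e) ≤ ∑ v ∈ V, hdeg H v := by
  classical
  calc #(H.filter fun e => ∃ v ∈ V, v ⊆ e)
      ≤ #(V.biUnion fun v => H.filter fun e => v ⊆ e) := by
        apply card_le_card
        intro e he
        simp only [mem_filter] at he
        obtain ⟨v, hv, hve⟩ := he.2
        simp only [mem_biUnion, mem_filter]
        exact ⟨v, hv, he.1, hve⟩
    _ ≤ ∑ v ∈ V, #(H.filter fun e => v ⊆ e) := card_biUnion_le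
    _ = ∑ v ∈ V, hdeg H v := rfl

/-- If every member of `H' ⊆ H` contains some member of `V` then `|H'| ≤ ∑_{v ∈ V} deg_H(v)`.
[folklore] -/
theorem card_le_sum_hdeg_of_exists_subset {H H' : Finset (Finset α)} (V : Finset (Finset α))
    (hH' : H' ⊆ H) (h : ∀ e ∈ H', ∃ v ∈ V, v ⊆ e) : #H' ≤ ∑ v ∈ V, hdeg H v := by
  classical
  calc #H' ≤ #(V.biUnion fun v => H.filter fun e => v ⊆ e) := by
        apply card_le_card
        intro e he
        obtain ⟨v, hv, hve⟩ := h e he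
        simp only [mem_biUnion, mem_filter]
        exact ⟨v, hv, hH' he, hve⟩
    _ ≤ ∑ v ∈ V, #(H.filter fun e => v ⊆ e) := card_biUnion_le
    _ = ∑ v ∈ V, hdeg H v := rfl

/-- Sums of nonnegative reals over a `biUnion` are at most the sums of the sums (private copy of
a lemma several Literature files prove locally, e.g. `MaynardTao.sum_biUnion_le_sum_sum`).
[folklore] -/
private theorem sum_biUnion_le_sum_sum {ι β : Type*} [DecidableEq β] (s : Finset ι) (t : ι → Finset β)
    (f : β → ℝ) (hf : ∀ b, 0 ≤ f b) : ∑ b ∈ s.biUnion t, f b ≤ ∑ a ∈ s, ∑ b ∈ t a, f b := by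
  classical
  induction s using Finset.induction_on with
  | empty => simp
  | insert a s ha ih =>
    rw [Finset.biUnion_insert, Finset.sum_insert ha]
    have h1 := Finset.sum_union_inter (s₁ := t a) (s₂ := s.biUnion t) (f := f)
    have h2 : 0 ≤ ∑ b ∈ t a ∩ s.biUnion t, f b := Finset.sum_nonneg fun b _ => hf b
    linarith

/-! ### Fibres -/

/-- The fibre of `H` over a vertex set `F`: `H_F = {e ∖ {f} : e ∈ H, f ∈ F ∩ e}` (BDTT Notation 2,
`H_U = {v : u ∪ v ∈ H for some u ∈ U}` with `U = {{f} : f ∈ F}`; for `F = {x}` this is the link of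
`x`). [cite: BernshteynEtAl2019, Notation 2] -/
def fiber (H : Finset (Finset α)) (F : Finset α) : Finset (Finset α) :=
  ((H ×ˢ F).filter fun p => p.2 ∈ p.1).image fun p => p.1.erase p.2

/-- Membership in a fibre. [folklore] -/
theorem mem_fiber {H : Finset (Finset α)} {F : Finset α} {v : Finset α} :
    v ∈ fiber H F ↔ ∃ f ∈ F, f ∉ v ∧ insert f v ∈ H := by
  simp only [fiber, mem_image, mem_filter, mem_product, Prod.exists]
  constructor
  · rintro ⟨e, f, ⟨⟨he, hf⟩, hfe⟩, rfl⟩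
    exact ⟨f, hf, notMem_erase f e, by rwa [insert_erase hfe]⟩
  · rintro ⟨f, hf, hfv, hins⟩
    exact ⟨insert f v, f, ⟨⟨hins, hf⟩, mem_insert_self f v⟩, by rw [erase_insert hfv]⟩

/-- Fibres are monotone in the family. [folklore] -/
theorem fiber_mono {H₁ H₂ : Finset (Finset α)} (h : H₁ ⊆ H₂) (F : Finset α) :
    fiber H₁ F ⊆ fiber H₂ F := by
  intro v hv
  rw [mem_fiber] at hv ⊢
  obtain ⟨f, hf, hfv, hins⟩ := hv
  exact ⟨f, hf, hfv, h hins⟩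

/-- Fibres are monotone in the vertex set. [folklore] -/
theorem fiber_mono_right (H : Finset (Finset α)) {F₁ F₂ : Finset α} (h : F₁ ⊆ F₂) :
    fiber H F₁ ⊆ fiber H F₂ := by
  intro v hv
  rw [mem_fiber] at hv ⊢
  obtain ⟨f, hf, hfv, hins⟩ := hv
  exact ⟨f, h hf, hfv, hins⟩

/-- The fibre of a `k`-uniform family on `X` is `(k-1)`-uniform on `X`. [folklore] -/
theorem fiber_subset_powersetCard {X : Finset α} {H : Finset (Finset α)} {k : ℕ}
    (hH : H ⊆ X.powersetCard k) (F : Finset α) : fiber H F ⊆ X.powersetCard (k - 1) := by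
  intro v hv
  rw [mem_fiber] at hv
  obtain ⟨f, -, hfv, hins⟩ := hv
  have h := mem_powersetCard.1 (hH hins)
  rw [mem_powersetCard]
  refine ⟨(subset_insert f v).trans h.1, ?_⟩
  rw [card_insert_of_notMem hfv] at h
  omega

/-- An `H`-independent set containing `F` is independent for (any subfamily of) the fibre `H_F`
(BDTT Remark 14). [cite: BernshteynEtAl2019, Remark 14] -/
theorem IsIndep.fiber {H : Finset (Finset α)} {I F : Finset α} (h : IsIndep H I) (hF : F ⊆ I) :
    IsIndep (fiber H F) I := by
  intro v hv hvI
  rw [mem_fiber] at hv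
  obtain ⟨f, hf, -, hins⟩ := hv
  exact h _ hins (insert_subset (hF hf) hvI)

/-- **Size of a fibre**: `|H_F| ≤ ∑_{f ∈ F} deg_H(f)`. [cite: BernshteynEtAl2019, Claim 20 (proof)] -/
theorem card_fiber_le_sum_hdeg (H : Finset (Finset α)) (F : Finset α) :
    #(fiber H F) ≤ ∑ f ∈ F, hdeg H {f} := by
  classical
  calc #(fiber H F) ≤ #((H ×ˢ F).filter fun p => p.2 ∈ p.1) := card_image_le
    _ = ∑ f ∈ F, #(H.filter fun e => f ∈ e) := by
        rw [card_filter, sum_product_right]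
        refine sum_congr rfl fun f _ => ?_
        rw [card_filter]
    _ = ∑ f ∈ F, hdeg H {f} := by
        refine sum_congr rfl fun f _ => ?_
        simp only [hdeg, singleton_subset_iff]

/-- The link of a vertex: `v ∈ H_{{x}} ↔ x ∉ v ∧ insert x v ∈ H`. [folklore] -/
theorem mem_fiber_singleton {H : Finset (Finset α)} {x : α} {v : Finset α} :
    v ∈ fiber H {x} ↔ x ∉ v ∧ insert x v ∈ H := by
  simp [mem_fiber]

/-- The link of `x` has `deg_H(x)` members. [folklore] -/
theorem card_fiber_singleton (H : Finset (Finset α)) (x : α) :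
    #(fiber H {x}) = hdeg H {x} := by
  classical
  rw [hdeg]
  symm
  refine card_bij (fun e _ => e.erase x) (fun e he => ?_) (fun e₁ he₁ e₂ he₂ h => ?_)
    (fun v hv => ?_)
  · simp only [mem_filter, singleton_subset_iff] at he
    rw [mem_fiber_singleton]
    exact ⟨notMem_erase x e, by rw [insert_erase he.2]; exact he.1⟩
  · simp only [mem_filter, singleton_subset_iff] at he₁ he₂
    rw [← insert_erase he₁.2, ← insert_erase he₂.2, h]
  · rw [mem_fiber_singleton] at hv
    refine ⟨insert x v, ?_, erase_insert hv.1⟩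
    simp only [mem_filter, singleton_subset_iff]
    exact ⟨hv.2, mem_insert_self x v⟩

/-- Co-degrees in a link: `deg_{H_x}(u) ≤ deg_H(insert x u)`. [folklore] -/
theorem hdeg_fiber_singleton_le (H : Finset (Finset α)) (x : α) (u : Finset α) :
    hdeg (fiber H {x}) u ≤ hdeg H (insert x u) := by
  classical
  unfold hdeg
  refine card_le_card_of_injOn (fun v => insert x v) (fun v hv => ?_) (fun v₁ hv₁ v₂ hv₂ h => ?_)
  · simp only [coe_filter, Set.mem_setOf_eq, mem_fiber_singleton] at hv ⊢
    exact ⟨hv.1.2, insert_subset_insert x hv.2⟩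
  · simp only [coe_filter, Set.mem_setOf_eq, mem_fiber_singleton] at hv₁ hv₂
    have := congrArg (fun s => Finset.erase s x) h
    simp only [erase_insert hv₁.1.1, erase_insert hv₂.1.1] at this
    exact this

/-! ### Boundedness (multiplicative form of BDTT's `δ`-bounded) -/

/-- `H` is `(k, D)`-bounded: `deg_H(u) ≤ D^{k - |u|}` for all vertex sets `u` with
`1 ≤ |u| ≤ k - 1` — BDTT Def. 4 ("`Δ_ℓ(H) ≤ |X|^{(k-ℓ)δ}` for all `ℓ ∈ {1, …, k-1}`") with
`D = |X|^δ`. [cite: BernshteynEtAl2019, Definition 4] -/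
def IsBounded (H : Finset (Finset α)) (k : ℕ) (D : ℝ) : Prop :=
  ∀ u : Finset α, 1 ≤ #u → #u + 1 ≤ k → (hdeg H u : ℝ) ≤ D ^ (k - #u)

/-- Boundedness passes to subfamilies. [folklore] -/
theorem IsBounded.anti {H₁ H₂ : Finset (Finset α)} {k : ℕ} {D : ℝ} (h : IsBounded H₂ k D)
    (hH : H₁ ⊆ H₂) : IsBounded H₁ k D := fun u hu huk =>
  (Nat.cast_le.2 (hdeg_mono hH u)).trans (h u hu huk)

/-- The empty family is bounded (for `D ≥ 0`). [folklore] -/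
theorem isBounded_empty (k : ℕ) {D : ℝ} (hD : 0 ≤ D) : IsBounded (∅ : Finset (Finset α)) k D :=
  fun u _ _ => by simp [hdeg]; positivity

/-! ### Print/container pairs in functional form -/

/-- **A print/container pair** for the set family `H` on the ground set `X` (BDTT Def. 5 and 7, in
functional form): a fingerprint map `print` producing `m` fingerprints of size `≤ Φ` inside each
independent set `I ⊆ X`, and a container map `cont` with `cont P ⊆ X` determined by the
fingerprints alone, such that `I ⊆ ⋃ᵢ print I i ∪ cont (print I)` and `|X ∖ cont (print I)| ≥ β`.
[cite: BernshteynEtAl2019, Definitions 5 and 7] -/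
structure IsContainerPair (X : Finset α) (H : Finset (Finset α)) (m : ℕ) (Φ β : ℝ)
    (print : Finset α → (Fin m → Finset α)) (cont : (Fin m → Finset α) → Finset α) : Prop where
  /-- containers live in the ground set -/
  cont_subset : ∀ P, cont P ⊆ X
  /-- fingerprints are subsets of the independent set -/
  print_subset : ∀ I, I ⊆ X → IsIndep H I → ∀ i, print I i ⊆ I
  /-- fingerprints are small -/
  card_print_le : ∀ I, I ⊆ X → IsIndep H I → ∀ i, (#(print I i) : ℝ) ≤ Φ
  /-- the independent set is captured by its fingerprints and their container -/
  subset_cont : ∀ I, I ⊆ X → IsIndep H I →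
    I ⊆ (Finset.univ.biUnion (print I)) ∪ cont (print I)
  /-- containers miss at least `β` points of `X` -/
  le_card_sdiff : ∀ I, I ⊆ X → IsIndep H I → β ≤ #(X \ cont (print I))

/-! ## The inductive step of the BDTT container theorem (uniformity `k = j + 2 ≥ 2`)

Multiplicative reparametrisation of BDTT §5.1: with `N = |X|`, `D = N^δ`, `η = N^{-ε}` the derived
constants are `D' = 2D` (`δ' = δ + log 2`), `η' = η² 2^{-2k}` (`ε' = 2ε + 2k log 2`),
`Φ = N/D` (`π = 1 - δ`), `Φ̃ = η 2^{-k} Φ` (`π̃ = π - ε - k log 2`), `η̃ = η 2^{-(k+1)}`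
(`ε̃ = ε + (k+1) log 2`). -/

section Step

/-- BDTT (eq. (5.1)/"expansive"): `F` satisfies `|H_F|_{δ'} ≥ |F| · |X|^{(k-1)δ' - ε̃}`, i.e. the
fibre
`H_F` contains a `(k-1, 2D)`-bounded subfamily of size `≥ |F| · η̃ · (2D)^{k-1}`.
[cite: BernshteynEtAl2019, Condition 13 (eq. expansive)] -/
def Expansive (H : Finset (Finset α)) (k : ℕ) (D η : ℝ) (F : Finset α) : Prop :=
  ∃ G ⊆ fiber H F, IsBounded G (k - 1) (2 * D) ∧
    (#F : ℝ) * (η * 2⁻¹ ^ (k + 1)) * (2 * D) ^ (k - 1) ≤ #G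

/-- BDTT Def. 11 ("expanding"): the fibre `H_F` contains a `(δ', ε')`-homogeneous subfamily, i.e. a
`(k-1, 2D)`-bounded subfamily of size `≥ η' · |X| · (2D)^{k-2}` with `η' = η² 2^{-2k}`.
[cite: BernshteynEtAl2019, Definition 11] -/
def Expanding (X : Finset α) (H : Finset (Finset α)) (k : ℕ) (D η : ℝ) (F : Finset α) : Prop :=
  ∃ G ⊆ fiber H F, IsBounded G (k - 1) (2 * D) ∧
    (η ^ 2 * 2⁻¹ ^ (2 * k)) * #X * (2 * D) ^ (k - 2) ≤ #G

/-- The edges removed in BDTT eq. (5.2): `e ∈ Ĥ` iff `e` contains a set `u`, `1 ≤ |u| ≤ k-1`, of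
large co-degree in the fibre, `deg_{H_F}(u) ≥ D^{k-1-|u|}` (for `|u| = k-1` this says `u ∈ H_F`,
BDTT's `[H_F, X]_H`; for `|u| ≤ k-2` it says `u ∈ ∇_{|u|}^δ(H_F)`).
[cite: BernshteynEtAl2019, Definition 17 and eq. (5.2)] -/
def Bad (H : Finset (Finset α)) (k : ℕ) (D : ℝ) (F e : Finset α) : Prop :=
  ∃ u ∈ e.powerset, 1 ≤ #u ∧ #u + 1 ≤ k ∧ D ^ (k - 1 - #u) ≤ (hdeg (fiber H F) u : ℝ)

/-- `H⁻ = H ∖ Ĥ` (BDTT eq. (5.2)): the edges of `H` containing no set of large fibre co-degree.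
[cite: BernshteynEtAl2019, eq. (5.2)] -/
noncomputable def hminus (H : Finset (Finset α)) (k : ℕ) (D : ℝ) (F : Finset α) :
    Finset (Finset α) :=
  H.filter fun e => ¬ ∃ u ∈ e.powerset, 1 ≤ #u ∧ #u + 1 ≤ k ∧
    D ^ (k - 1 - #u) ≤ (hdeg (fiber H F) u : ℝ)

/-- The container of a non-expanding fingerprint (BDTT eq. (5.3)):
`C = {x ∈ X : deg_{H⁻}(x) < η̃ (2D)^{k-1}}`. [cite: BernshteynEtAl2019, eq. (5.3)] -/
noncomputable def cset (X : Finset α) (H : Finset (Finset α)) (k : ℕ) (D η : ℝ) (F : Finset α) :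
    Finset α :=
  X.filter fun x => (hdeg (hminus H k D F) {x} : ℝ) < (η * 2⁻¹ ^ (k + 1)) * (2 * D) ^ (k - 1)

/-- `∇_t`: the `t`-subsets of `X` of large co-degree in the fibre `H_F`
(BDTT Def. 17, threshold `D^{k-1-t}`). [cite: BernshteynEtAl2019, Definition 17] -/
noncomputable def nabla (X : Finset α) (H : Finset (Finset α)) (k : ℕ) (D : ℝ) (F : Finset α)
    (t : ℕ) : Finset (Finset α) :=
  (X.powersetCard t).filter fun u => D ^ (k - 1 - t) ≤ (hdeg (fiber H F) u : ℝ)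

variable {X : Finset α} {H : Finset (Finset α)} {k : ℕ} {D η : ℝ}

/-- `H⁻ ⊆ H`. [folklore] -/
theorem hminus_subset (H : Finset (Finset α)) (k : ℕ) (D : ℝ) (F : Finset α) :
    hminus H k D F ⊆ H := filter_subset _ _

/-- Membership in `H⁻`: the edges of `H` that are not removed. [folklore] -/
theorem mem_hminus {F e : Finset α} : e ∈ hminus H k D F ↔ e ∈ H ∧ ¬ Bad H k D F e := by
  unfold hminus Bad
  rw [mem_filter]

/-- The container lies in the ground set. [folklore] -/
theorem cset_subset (X : Finset α) (H : Finset (Finset α)) (k : ℕ) (D η : ℝ) (F : Finset α) :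
    cset X H k D η F ⊆ X := filter_subset _ _

/-- Membership in the container `C(F)`. [folklore] -/
theorem mem_cset {F : Finset α} {x : α} : x ∈ cset X H k D η F ↔
    x ∈ X ∧ (hdeg (hminus H k D F) {x} : ℝ) < (η * 2⁻¹ ^ (k + 1)) * (2 * D) ^ (k - 1) := by
  unfold cset
  rw [mem_filter]

/-- Membership in `∇_t`. [folklore] -/
theorem mem_nabla {F u : Finset α} {t : ℕ} : u ∈ nabla X H k D F t ↔
    (u ⊆ X ∧ #u = t) ∧ D ^ (k - 1 - t) ≤ (hdeg (fiber H F) u : ℝ) := by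
  unfold nabla
  rw [mem_filter, mem_powersetCard]

/-! ### BDTT Claims 20–22: few edges are removed -/

/-- `|H_F| ≤ |F| D^{k-1}` (BDTT: `log |H_F| ≤ log |F| + (k-1)δ`).
[cite: BernshteynEtAl2019, Claim 20 (proof)] -/
theorem card_fiber_le (hk : 2 ≤ k) (hB : IsBounded H k D) (F : Finset α) :
    (#(fiber H F) : ℝ) ≤ #F * D ^ (k - 1) := by
  calc (#(fiber H F) : ℝ) ≤ ∑ f ∈ F, (hdeg H {f} : ℝ) := by
        exact_mod_cast card_fiber_le_sum_hdeg H F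
    _ ≤ ∑ _f ∈ F, D ^ (k - 1) := by
        refine sum_le_sum fun f _ => ?_
        have h := hB {f} (by simp) (by simp; omega)
        simpa using h
    _ = #F * D ^ (k - 1) := by rw [sum_const, nsmul_eq_mul]

/-- `|∇_t| · D^{k-1-t} ≤ C(k-1, t) |F| D^{k-1}` for `1 ≤ t ≤ k - 1` (BDTT Claim 21, first display,
together with `|H_F| ≤ |F| D^{k-1}`). [cite: BernshteynEtAl2019, Claim 21] -/
theorem card_nabla_mul_le (hk : 2 ≤ k) (hH : H ⊆ X.powersetCard k) (hB : IsBounded H k D)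
    (F : Finset α) (t : ℕ) :
    (#(nabla X H k D F t) : ℝ) * D ^ (k - 1 - t) ≤ (k - 1).choose t * (#F * D ^ (k - 1)) := by
  have hfib := fiber_subset_powersetCard hH F
  calc (#(nabla X H k D F t) : ℝ) * D ^ (k - 1 - t)
      = ∑ _u ∈ nabla X H k D F t, D ^ (k - 1 - t) := by rw [sum_const, nsmul_eq_mul]
    _ ≤ ∑ u ∈ nabla X H k D F t, (hdeg (fiber H F) u : ℝ) :=
        sum_le_sum fun u hu => (mem_nabla.1 hu).2
    _ ≤ ∑ u ∈ X.powersetCard t, (hdeg (fiber H F) u : ℝ) := by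
        refine sum_le_sum_of_subset_of_nonneg (fun u hu => ?_) fun _ _ _ => by positivity
        exact mem_powersetCard.2 (mem_nabla.1 hu).1
    _ = ((k - 1).choose t * #(fiber H F) : ℕ) := by
        rw [← sum_hdeg_powersetCard hfib t]
        push_cast
        rfl
    _ ≤ (k - 1).choose t * (#F * D ^ (k - 1)) := by
        push_cast
        exact mul_le_mul_of_nonneg_left (card_fiber_le hk hB F) (by positivity)

/-- The removed edges `H ∖ H⁻` all contain a member of some `∇_t`, `1 ≤ t ≤ k-1`. [folklore] -/
theorem exists_nabla_of_mem_sdiff_hminus (hH : H ⊆ X.powersetCard k) (F : Finset α) {e : Finset α}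
    (he : e ∈ H \ hminus H k D F) :
    ∃ v ∈ (Finset.range (k - 1)).biUnion (fun t => nabla X H k D F (t + 1)), v ⊆ e := by
  rw [mem_sdiff, mem_hminus] at he
  have hbad : Bad H k D F e := by
    by_contra h
    exact he.2 ⟨he.1, h⟩
  obtain ⟨u, hue, hu1, huk, hdeg_u⟩ := hbad
  rw [mem_powerset] at hue
  refine ⟨u, ?_, hue⟩
  rw [mem_biUnion]
  refine ⟨#u - 1, ?_, ?_⟩
  · rw [Finset.mem_range]; omega
  · rw [mem_nabla]
    refine ⟨⟨hue.trans (mem_powersetCard.1 (hH he.1)).1, by omega⟩, ?_⟩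
    rw [show #u - 1 + 1 = #u by omega]
    exact hdeg_u

/-- **BDTT Claim 22 (few edges removed)**: `|H ∖ H⁻| ≤ (2^{k-1} - 1) |F| D^k`, so that for
`|F| ≤ Φ̃ = η 2^{-k} |X| / D` at most half of the (`≥ η |X| D^{k-1}`) edges are removed.
[cite: BernshteynEtAl2019, Claim 22] -/
theorem card_le_card_hminus_add (hk : 2 ≤ k) (hH : H ⊆ X.powersetCard k) (hD : 0 ≤ D)
    (hB : IsBounded H k D) (F : Finset α) :
    (#H : ℝ) ≤ #(hminus H k D F) + (2 ^ (k - 1) - 1) * (#F * D ^ k) := by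
  have hsplit : (#H : ℝ) = #(hminus H k D F) + #(H \ hminus H k D F) := by
    have h := card_sdiff_add_card_eq_card (hminus_subset H k D F)
    have : (#(H \ hminus H k D F) : ℝ) + #(hminus H k D F) = #H := by exact_mod_cast h
    linarith
  have hrem : (#(H \ hminus H k D F) : ℝ) ≤ (2 ^ (k - 1) - 1) * (#F * D ^ k) :=
    calc (#(H \ hminus H k D F) : ℝ)
        ≤ ∑ v ∈ (Finset.range (k - 1)).biUnion (fun t => nabla X H k D F (t + 1)),
            (hdeg H v : ℝ) := by
          exact_mod_cast card_le_sum_hdeg_of_exists_subset _ sdiff_subset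
            fun e he => exists_nabla_of_mem_sdiff_hminus hH F he
      _ ≤ ∑ t ∈ Finset.range (k - 1), ∑ v ∈ nabla X H k D F (t + 1), (hdeg H v : ℝ) :=
          sum_biUnion_le_sum_sum _ _ _ fun _ => by positivity
      _ ≤ ∑ t ∈ Finset.range (k - 1), (k - 1).choose (t + 1) * (#F * D ^ k) := by
          refine sum_le_sum fun t ht => ?_
          rw [Finset.mem_range] at ht
          calc ∑ v ∈ nabla X H k D F (t + 1), (hdeg H v : ℝ)
              ≤ ∑ _v ∈ nabla X H k D F (t + 1), D ^ (k - (t + 1)) := by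
                refine sum_le_sum fun v hv => ?_
                have hv' := (mem_nabla.1 hv).1
                have h := hB v (by rw [hv'.2]; omega) (by rw [hv'.2]; omega)
                rw [hv'.2] at h
                exact h
            _ = #(nabla X H k D F (t + 1)) * D ^ (k - 1 - (t + 1)) * D := by
                rw [sum_const, nsmul_eq_mul, mul_assoc, ← pow_succ]
                congr 2
                omega
            _ ≤ (k - 1).choose (t + 1) * (#F * D ^ (k - 1)) * D :=
                mul_le_mul_of_nonneg_right (card_nabla_mul_le hk hH hB F (t + 1)) hD
            _ = (k - 1).choose (t + 1) * (#F * D ^ k) := by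
                rw [mul_assoc, mul_assoc, ← pow_succ]
                congr 3
                omega
      _ = (∑ t ∈ Finset.range (k - 1), ((k - 1).choose (t + 1) : ℝ)) * (#F * D ^ k) := by
          rw [sum_mul]
      _ = (2 ^ (k - 1) - 1) * (#F * D ^ k) := by
          congr 1
          have hsum : ∑ t ∈ Finset.range (k - 1 + 1), ((k - 1).choose t : ℝ) = 2 ^ (k - 1) := by
            exact_mod_cast Nat.sum_range_choose (k - 1)
          rw [Finset.sum_range_succ', Nat.choose_zero_right, Nat.cast_one] at hsum
          linarith
  linarith

/-! ### BDTT §5.7: the container of a small non-expanding fingerprint misses `η|X|/4` points -/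

/-- `η̃ (2D)^{k-1} = η D^{k-1} / 4` (the threshold defining the container). [folklore] -/
theorem threshold_eq (hk : 1 ≤ k) (D η : ℝ) :
    (η * 2⁻¹ ^ (k + 1)) * (2 * D) ^ (k - 1) = η / 4 * D ^ (k - 1) := by
  obtain ⟨j, rfl⟩ : ∃ j, k = j + 1 := ⟨k - 1, by omega⟩
  rw [show j + 1 - 1 = j by omega, show j + 1 + 1 = j + 2 by omega, mul_pow, ← mul_assoc,
    mul_assoc η, pow_add, mul_assoc _ _ ((2 : ℝ) ^ j), mul_comm _ ((2 : ℝ) ^ j),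
    ← mul_assoc (2⁻¹ ^ j), ← mul_pow]
  norm_num
  left
  ring

/-- **BDTT §5.7, case 2**: if `|F| ≤ Φ̃ = η 2^{-k} |X|/D` then `|X ∖ C(F)| ≥ η |X| / 4`
(BDTT: `log |X ∖ C| ≥ 1 - ε - 2 log 2`). [cite: BernshteynEtAl2019, §5.7 (Case 2)] -/
theorem le_card_sdiff_cset (hk : 2 ≤ k) (hH : H ⊆ X.powersetCard k) (hD : 0 < D) (hη : 0 ≤ η)
    (hB : IsBounded H k D) (hcard : η * #X * D ^ (k - 1) ≤ #H) (F : Finset α)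
    (hF : (#F : ℝ) ≤ η * 2⁻¹ ^ k * (#X / D)) :
    η / 4 * #X ≤ #(X \ cset X H k D η F) := by
  have hDk : (0 : ℝ) < D ^ (k - 1) := pow_pos hD _
  -- (1) at most half of the edges are removed
  have h22 := card_le_card_hminus_add hk hH hD.le hB F
  have hrem : (2 ^ (k - 1) - 1) * (#F * D ^ k) ≤ η / 2 * #X * D ^ (k - 1) := by
    obtain ⟨j, rfl⟩ : ∃ j, k = j + 2 := ⟨k - 2, by omega⟩
    rw [show j + 2 - 1 = j + 1 by omega]
    have hF' : (#F : ℝ) * D ≤ η * 2⁻¹ ^ (j + 2) * #X := by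
      have := mul_le_mul_of_nonneg_right hF hD.le
      rwa [mul_assoc (η * 2⁻¹ ^ (j + 2)), div_mul_cancel₀ _ hD.ne'] at this
    have hpow : (2 : ℝ) ^ (j + 1) * 2⁻¹ ^ (j + 2) = 2⁻¹ := by
      rw [pow_succ (2⁻¹ : ℝ) (j + 1), ← mul_assoc, ← mul_pow]; norm_num
    calc ((2 : ℝ) ^ (j + 1) - 1) * (#F * D ^ (j + 2))
        ≤ 2 ^ (j + 1) * (#F * D ^ (j + 2)) := by
          apply mul_le_mul_of_nonneg_right (by linarith) (by positivity)
      _ = 2 ^ (j + 1) * (#F * D) * D ^ (j + 1) := by ring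
      _ ≤ 2 ^ (j + 1) * (η * 2⁻¹ ^ (j + 2) * #X) * D ^ (j + 1) := by
          apply mul_le_mul_of_nonneg_right _ hDk.le
          exact mul_le_mul_of_nonneg_left hF' (by positivity)
      _ = η / 2 * #X * D ^ (j + 1) := by
          rw [show (2 : ℝ) ^ (j + 1) * (η * 2⁻¹ ^ (j + 2) * #X) =
            (2 ^ (j + 1) * 2⁻¹ ^ (j + 2)) * η * #X by ring, hpow]
          ring
  have hminus_ge : η / 2 * #X * D ^ (k - 1) ≤ #(hminus H k D F) := by linarith
  -- (2) count the edges of `H⁻` through their vertices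
  have hmeet : ∀ e ∈ hminus H k D F, (e ∩ X).Nonempty := by
    intro e he
    have he' := mem_powersetCard.1 (hH (hminus_subset H k D F he))
    rw [inter_eq_left.2 he'.1, ← card_pos, he'.2]
    omega
  have hsum := card_le_sum_hdeg_of_meets (hminus H k D F) X hmeet
  have hsumR : (#(hminus H k D F) : ℝ) ≤ ∑ x ∈ X, (hdeg (hminus H k D F) {x} : ℝ) := by
    exact_mod_cast hsum
  rw [← sum_sdiff (cset_subset X H k D η F)] at hsumR
  -- vertices of the container have small `H⁻`-degree, the others degree `≤ D^{k-1}`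
  have hin : ∑ x ∈ cset X H k D η F, (hdeg (hminus H k D F) {x} : ℝ) ≤
      #X * (η / 4 * D ^ (k - 1)) := by
    calc ∑ x ∈ cset X H k D η F, (hdeg (hminus H k D F) {x} : ℝ)
        ≤ ∑ _x ∈ cset X H k D η F, η / 4 * D ^ (k - 1) := by
          refine sum_le_sum fun x hx => ?_
          have h := (mem_cset.1 hx).2
          rw [threshold_eq (by omega)] at h
          exact h.le
      _ = #(cset X H k D η F) * (η / 4 * D ^ (k - 1)) := by rw [sum_const, nsmul_eq_mul]
      _ ≤ #X * (η / 4 * D ^ (k - 1)) := by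
          apply mul_le_mul_of_nonneg_right _ (by positivity)
          exact_mod_cast card_le_card (cset_subset X H k D η F)
  have hout : ∑ x ∈ X \ cset X H k D η F, (hdeg (hminus H k D F) {x} : ℝ) ≤
      #(X \ cset X H k D η F) * D ^ (k - 1) := by
    calc ∑ x ∈ X \ cset X H k D η F, (hdeg (hminus H k D F) {x} : ℝ)
        ≤ ∑ _x ∈ X \ cset X H k D η F, D ^ (k - 1) := by
          refine sum_le_sum fun x _ => ?_
          calc (hdeg (hminus H k D F) {x} : ℝ) ≤ hdeg H {x} := by
                exact_mod_cast hdeg_mono (hminus_subset H k D F) {x}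
            _ ≤ D ^ (k - 1) := by
                have h := hB {x} (by simp) (by simp; omega)
                simpa using h
      _ = #(X \ cset X H k D η F) * D ^ (k - 1) := by rw [sum_const, nsmul_eq_mul]
  have hfinal : η / 4 * #X * D ^ (k - 1) ≤ #(X \ cset X H k D η F) * D ^ (k - 1) := by
    nlinarith
  exact le_of_mul_le_mul_right hfinal hDk

/-! ### BDTT Claim 15: large expansive fingerprints are expanding -/

/-- `Φ̃ · η̃ (2D)^{k-1} = η' |X| (2D)^{k-2}` (BDTT, proof of Claim 15: `π̃ + (k-1)δ' - ε̃ =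
1 + (k-2)δ' - ε'`). [cite: BernshteynEtAl2019, Claim 15 (proof)] -/
theorem phiTilde_mul_threshold (hk : 2 ≤ k) (hD : D ≠ 0) (η N : ℝ) :
    (η * 2⁻¹ ^ k * (N / D)) * (η * 2⁻¹ ^ (k + 1)) * (2 * D) ^ (k - 1) =
      (η ^ 2 * 2⁻¹ ^ (2 * k)) * N * (2 * D) ^ (k - 2) := by
  obtain ⟨j, rfl⟩ : ∃ j, k = j + 2 := ⟨k - 2, by omega⟩
  rw [show j + 2 - 1 = j + 1 by omega, show j + 2 - 2 = j by omega,
    show 2 * (j + 2) = (j + 2) + (j + 1) + 1 by ring]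
  simp only [pow_succ, pow_add, mul_pow]
  field_simp

/-- **BDTT Claim 15**: an expansive `π`-fingerprint with `|F| ≥ Φ̃ = η 2^{-k} |X| / D` is
expanding. [cite: BernshteynEtAl2019, Claim 15] -/
theorem expanding_of_expansive (hk : 2 ≤ k) (hD : 0 < D) (hη : 0 ≤ η) {F : Finset α}
    (hF : Expansive H k D η F) (hcard : η * 2⁻¹ ^ k * (#X / D) ≤ #F) :
    Expanding X H k D η F := by
  obtain ⟨G, hGsub, hGbdd, hGcard⟩ := hF
  refine ⟨G, hGsub, hGbdd, ?_⟩
  rw [← phiTilde_mul_threshold hk hD.ne' η #X]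
  refine le_trans ?_ hGcard
  apply mul_le_mul_of_nonneg_right _ (by positivity)
  exact mul_le_mul_of_nonneg_right hcard (by positivity)

/-! ### BDTT §5.6 (Claim 19): adding a vertex of large `H⁻`-degree keeps a fingerprint expansive -/

/-- The link of `x` in `H⁻` misses every set `u` of large fibre co-degree and every set
containing `x`. [cite: BernshteynEtAl2019, Claim 19 (proof, first case)] -/
theorem hdeg_fiber_hminus_eq_zero (hk : 2 ≤ k) {F u : Finset α} {x : α} (hu1 : 1 ≤ #u)
    (huk : #u + 1 ≤ k - 1)
    (hcase : x ∈ u ∨ D ^ (k - 1 - #u) ≤ (hdeg (fiber H F) u : ℝ)) :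
    hdeg (fiber (hminus H k D F) {x}) u = 0 := by
  rw [hdeg, card_eq_zero, filter_eq_empty_iff]
  intro v hv huv
  rw [mem_fiber_singleton, mem_hminus] at hv
  rcases hcase with hxu | hcond
  · exact hv.1 (huv hxu)
  · refine hv.2.2 ⟨u, ?_, hu1, by omega, hcond⟩
    rw [mem_powerset]
    exact huv.trans (subset_insert x v)

/-- The link of `x` in `H⁻` is disjoint from the fibre `H_F` (BDTT: "`H⁻` and `[H_F, X]_H` are
disjoint, in particular `H⁻_x` and `H_F ⊇ G` are disjoint").
[cite: BernshteynEtAl2019, §5.6 (after Claim 19)] -/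
theorem disjoint_fiber_hminus (hk : 2 ≤ k) (hH : H ⊆ X.powersetCard k) (F : Finset α) (x : α) :
    Disjoint (fiber H F) (fiber (hminus H k D F) {x}) := by
  rw [disjoint_left]
  intro v hvF hvL
  rw [mem_fiber_singleton, mem_hminus] at hvL
  have hv := mem_powersetCard.1 (fiber_subset_powersetCard hH F hvF)
  refine hvL.2.2 ⟨v, ?_, by omega, by omega, ?_⟩
  · rw [mem_powerset]
    exact subset_insert x v
  · rw [hv.2, show k - 1 - (k - 1) = 0 by omega, pow_zero]
    have : 1 ≤ hdeg (fiber H F) v := by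
      rw [hdeg, Nat.one_le_iff_ne_zero, ← Nat.pos_iff_ne_zero, card_pos]
      exact ⟨v, mem_filter.2 ⟨hvF, Subset.rfl⟩⟩
    exact_mod_cast this

/-- **BDTT Claim 19 and the size count of §5.6**: if `F` is expansive, `x ∉ F`, and
`deg_{H⁻}(x) ≥ η̃ (2D)^{k-1}` (i.e. `x ∉ C(F)`), then `insert x F` is expansive, witnessed by
`G' = G ∪ H⁻_x`. [cite: BernshteynEtAl2019, Claim 19 and §5.6] -/
theorem expansive_insert (hk : 2 ≤ k) (hH : H ⊆ X.powersetCard k) (hD : 0 ≤ D)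
    (hB : IsBounded H k D) {F : Finset α} {x : α} (hF : Expansive H k D η F) (hxF : x ∉ F)
    (hx : (η * 2⁻¹ ^ (k + 1)) * (2 * D) ^ (k - 1) ≤ (hdeg (hminus H k D F) {x} : ℝ)) :
    Expansive H k D η (insert x F) := by
  obtain ⟨G, hGsub, hGbdd, hGcard⟩ := hF
  set L := fiber (hminus H k D F) {x} with hL
  refine ⟨G ∪ L, ?_, ?_, ?_⟩
  · -- `G' ⊆ H_{F ∪ {x}}`
    refine union_subset (hGsub.trans (fiber_mono_right H (subset_insert x F))) ?_
    exact (fiber_mono (hminus_subset H k D F) {x}).trans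
      (fiber_mono_right H (by simp))
  · -- Claim 19: `G'` is `(k-1, 2D)`-bounded
    intro u hu1 huk
    by_cases hcase : x ∈ u ∨ D ^ (k - 1 - #u) ≤ (hdeg (fiber H F) u : ℝ)
    · have h0 := hdeg_fiber_hminus_eq_zero (H := H) (D := D) (F := F) hk hu1 huk hcase
      calc (hdeg (G ∪ L) u : ℝ) ≤ (hdeg G u + hdeg L u : ℕ) := by
            exact_mod_cast hdeg_union_le G L u
        _ = hdeg G u := by rw [hL, h0, add_zero]
        _ ≤ (2 * D) ^ (k - 1 - #u) := hGbdd u hu1 huk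
    · push Not at hcase
      obtain ⟨hxu, hlt⟩ := hcase
      have h1 : (hdeg G u : ℝ) ≤ D ^ (k - 1 - #u) :=
        le_trans (by exact_mod_cast hdeg_mono hGsub u) hlt.le
      have h2 : (hdeg L u : ℝ) ≤ D ^ (k - 1 - #u) := by
        have hins : #(insert x u) = #u + 1 := card_insert_of_notMem hxu
        calc (hdeg L u : ℝ) ≤ hdeg (fiber H {x}) u := by
              exact_mod_cast hdeg_mono (fiber_mono (hminus_subset H k D F) {x}) u
          _ ≤ hdeg H (insert x u) := by exact_mod_cast hdeg_fiber_singleton_le H x u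
          _ ≤ D ^ (k - #(insert x u)) := hB _ (by rw [hins]; omega) (by rw [hins]; omega)
          _ = D ^ (k - 1 - #u) := by rw [hins]; congr 1; omega
      have hm : 1 ≤ k - 1 - #u := by omega
      calc (hdeg (G ∪ L) u : ℝ) ≤ (hdeg G u + hdeg L u : ℕ) := by
            exact_mod_cast hdeg_union_le G L u
        _ ≤ 2 * D ^ (k - 1 - #u) := by push_cast; linarith
        _ ≤ (2 * D) ^ (k - 1 - #u) := by
            rw [mul_pow]
            apply mul_le_mul_of_nonneg_right _ (by positivity)
            calc (2 : ℝ) = 2 ^ 1 := (pow_one 2).symm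
              _ ≤ 2 ^ (k - 1 - #u) := pow_le_pow_right₀ (by norm_num) hm
  · -- the size count: `|G'| = |G| + |H⁻_x| ≥ (|F| + 1) η̃ (2D)^{k-1}`
    have hdisj : Disjoint G L :=
      (disjoint_fiber_hminus (D := D) hk hH F x).mono_left hGsub
    rw [card_union_of_disjoint hdisj, card_insert_of_notMem hxF, hL, card_fiber_singleton]
    push_cast
    linarith

/-! ### Assembly of the inductive step (BDTT §5.2–5.7) -/

/-- Numeric bookkeeping: `η^{3^{k-1}} ≤ (η')^{3^{k-2}}` for `η ≤ 2^{-2k}` (`σ' ≤ σ`).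
[cite: BernshteynEtAl2019, §5.1] -/
theorem pow_three_pow_le (j : ℕ) (hη : 0 ≤ η) (hη2 : η ≤ 2⁻¹ ^ (2 * (j + 2))) :
    η ^ (3 ^ (j + 1)) ≤ (η ^ 2 * 2⁻¹ ^ (2 * (j + 2))) ^ (3 ^ j) := by
  calc η ^ (3 ^ (j + 1)) = (η ^ 2 * η) ^ (3 ^ j) := by rw [← pow_succ, ← pow_mul, pow_succ 3 j, mul_comm]
    _ ≤ (η ^ 2 * 2⁻¹ ^ (2 * (j + 2))) ^ (3 ^ j) := by
        apply pow_le_pow_left₀ (by positivity)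
        exact mul_le_mul_of_nonneg_left hη2 (by positivity)

/-- Numeric bookkeeping: `η^{3^{k-1}} ≤ η/4` for `η ≤ 2^{-2k}`, `k ≥ 2`
(BDTT: `1 - ε - 2 log 2 > 1 - σ`). [cite: BernshteynEtAl2019, §5.7 (last display)] -/
theorem pow_three_pow_le_div_four (j : ℕ) (hη : 0 ≤ η) (hη2 : η ≤ 2⁻¹ ^ (2 * (j + 2))) :
    η ^ (3 ^ (j + 1)) ≤ η / 4 := by
  have hη1 : η ≤ 2⁻¹ ^ 4 := hη2.trans (pow_le_pow_of_le_one (by norm_num) (by norm_num) (by omega))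
  have hη1' : η ≤ 1 := hη1.trans (by norm_num)
  calc η ^ (3 ^ (j + 1)) ≤ η ^ 3 := pow_le_pow_of_le_one hη hη1' (Nat.le_self_pow (by positivity) 3)
    _ = η * (η * η) := by ring
    _ ≤ η * (2⁻¹ ^ 4 * 1) := by
        apply mul_le_mul_of_nonneg_left _ hη
        exact mul_le_mul hη1 hη1' hη (by positivity)
    _ ≤ η / 4 := by norm_num; linarith

section Assembly

open scoped Classical

/-- The hypotheses of the inductive step at uniformity `k = j + 2`, including the induction
hypothesis for `(j+1)`-uniform families with the constants `D' = 2D`, `η' = η² 2^{-2k}`.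
[cite: BernshteynEtAl2019, Theorem 8 and §5.1] -/
structure StepHyp (X : Finset α) (H : Finset (Finset α)) (j : ℕ) (D η : ℝ) : Prop where
  hH : H ⊆ X.powersetCard (j + 2)
  hD : 0 < D
  hη : 0 < η
  hη2 : η ≤ 2⁻¹ ^ (2 * (j + 2))
  hXD : 2 ^ (j + 1) * D ≤ #X
  hB : IsBounded H (j + 2) D
  hcard : η * #X * D ^ (j + 1) ≤ #H
  IH : ∀ G ⊆ X.powersetCard (j + 1), IsBounded G (j + 1) (2 * D) →
      (η ^ 2 * 2⁻¹ ^ (2 * (j + 2))) * #X * (2 * D) ^ j ≤ #G →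
      ∃ (pr : Finset α → (Fin j → Finset α)) (co : (Fin j → Finset α) → Finset α),
        IsContainerPair X G j (#X / (2 * D)) ((η ^ 2 * 2⁻¹ ^ (2 * (j + 2))) ^ (3 ^ j) * #X) pr co

variable {j : ℕ}

/-- The chosen `(δ', ε')`-homogeneous subfamily `G_F` of the fibre of an expanding fingerprint
(arbitrary, `∅`, for non-expanding `F`). [cite: BernshteynEtAl2019, §5.1 (choice of G_F)] -/
noncomputable def gsel (H : Finset (Finset α)) (X : Finset α) (j : ℕ) (D η : ℝ) (F : Finset α) :
    Finset (Finset α) :=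
  if h : Expanding X H (j + 2) D η F then Classical.choose h else ∅

/-- The defining property of the chosen subfamily `G_F` of an expanding fingerprint. [folklore] -/
theorem gsel_spec {F : Finset α} (h : Expanding X H (j + 2) D η F) :
    gsel H X j D η F ⊆ fiber H F ∧ IsBounded (gsel H X j D η F) (j + 1) (2 * D) ∧
      (η ^ 2 * 2⁻¹ ^ (2 * (j + 2))) * #X * (2 * D) ^ j ≤ #(gsel H X j D η F) := by
  unfold gsel
  rw [dif_pos h]
  exact Classical.choose_spec h

/-- `G_F` is a family of `(k-1)`-subsets of `X`. [folklore] -/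
theorem gsel_subset_powersetCard (S : StepHyp X H j D η) {F : Finset α}
    (h : Expanding X H (j + 2) D η F) : gsel H X j D η F ⊆ X.powersetCard (j + 1) :=
  (gsel_spec h).1.trans (fiber_subset_powersetCard S.hH F)

/-- The print/container pair of `G_F` given by the induction hypothesis (BDTT §5.1: "fix any such
`(π', σ')`-print/container pair"); junk `(∅, ∅)` for non-expanding `F`.
[cite: BernshteynEtAl2019, §5.1] -/
noncomputable def pairSel (S : StepHyp X H j D η) (F : Finset α) :
    (Finset α → (Fin j → Finset α)) × ((Fin j → Finset α) → Finset α) :=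
  if h : Expanding X H (j + 2) D η F then
    ⟨Classical.choose (S.IH _ (gsel_subset_powersetCard S h) (gsel_spec h).2.1 (gsel_spec h).2.2),
      Classical.choose (Classical.choose_spec
        (S.IH _ (gsel_subset_powersetCard S h) (gsel_spec h).2.1 (gsel_spec h).2.2))⟩
  else ⟨fun _ _ => ∅, fun _ => ∅⟩

/-- The chosen pair of `G_F` is a print/container pair (induction hypothesis). [folklore] -/
theorem pairSel_spec (S : StepHyp X H j D η) {F : Finset α} (h : Expanding X H (j + 2) D η F) :
    IsContainerPair X (gsel H X j D η F) j (#X / (2 * D))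
      ((η ^ 2 * 2⁻¹ ^ (2 * (j + 2))) ^ (3 ^ j) * #X) (pairSel S F).1 (pairSel S F).2 := by
  unfold pairSel
  rw [dif_pos h]
  exact Classical.choose_spec (Classical.choose_spec
    (S.IH _ (gsel_subset_powersetCard S h) (gsel_spec h).2.1 (gsel_spec h).2.2))

/-- The expansive `π`-fingerprints inside `I` (candidates for BDTT Condition 13).
[cite: BernshteynEtAl2019, Condition 13] -/
noncomputable def candidates (H : Finset (Finset α)) (k : ℕ) (D η Φ : ℝ) (I : Finset α) :
    Finset (Finset α) :=
  I.powerset.filter fun F => (#F : ℝ) ≤ Φ ∧ Expansive H k D η F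

/-- Membership in the candidate family. [folklore] -/
theorem mem_candidates {Φ : ℝ} {I F : Finset α} :
    F ∈ candidates H k D η Φ I ↔ F ⊆ I ∧ (#F : ℝ) ≤ Φ ∧ Expansive H k D η F := by
  simp only [candidates, mem_filter, mem_powerset]

/-- The empty fingerprint is expansive (BDTT: "Because `F = ∅` satisfies (5.1) …").
[cite: BernshteynEtAl2019, Claim 15 (proof)] -/
theorem expansive_empty (hD : 0 ≤ D) : Expansive H k D η ∅ :=
  ⟨∅, empty_subset _, isBounded_empty _ (by positivity), by simp⟩

/-- The candidate family is nonempty (it contains `∅`). [folklore] -/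
theorem candidates_nonempty (hD : 0 ≤ D) {Φ : ℝ} (hΦ : 0 ≤ Φ) (I : Finset α) :
    (candidates H k D η Φ I).Nonempty :=
  ⟨∅, mem_candidates.2 ⟨empty_subset _, by simpa using hΦ, expansive_empty hD⟩⟩

/-- A maximum-size expansive `π`-fingerprint inside `I` (BDTT Claim 15 / Condition 13).
[cite: BernshteynEtAl2019, Claim 15] -/
noncomputable def fmax (hD : 0 ≤ D) {Φ : ℝ} (hΦ : 0 ≤ Φ) (H : Finset (Finset α)) (k : ℕ) (η : ℝ)
    (I : Finset α) : Finset α :=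
  Classical.choose ((candidates H k D η Φ I).exists_max_image card (candidates_nonempty hD hΦ I))

/-- The defining property of the maximum-size candidate. [folklore] -/
theorem fmax_spec (hD : 0 ≤ D) {Φ : ℝ} (hΦ : 0 ≤ Φ) (I : Finset α) :
    fmax hD hΦ H k η I ∈ candidates H k D η Φ I ∧
      ∀ F ∈ candidates H k D η Φ I, #F ≤ #(fmax hD hΦ H k η I) :=
  Classical.choose_spec ((candidates H k D η Φ I).exists_max_image card
    (candidates_nonempty hD hΦ I))

/-- `Φ = |X|/D ≥ 0`. [folklore] -/
theorem StepHyp.phi_nonneg (S : StepHyp X H j D η) : (0 : ℝ) ≤ #X / D :=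
  div_nonneg (Nat.cast_nonneg _) S.hD.le

/-- The print map of the inductive step (BDTT §5.2, Conditions 12 and 13).
[cite: BernshteynEtAl2019, §5.2] -/
noncomputable def stepPrint (S : StepHyp X H j D η) (I : Finset α) : Fin (j + 1) → Finset α :=
  if h : ∃ F, F ⊆ I ∧ (#F : ℝ) ≤ #X / D ∧ Expanding X H (j + 2) D η F then
    Fin.cons (Classical.choose h) ((pairSel S (Classical.choose h)).1 I)
  else Fin.cons (fmax S.hD.le S.phi_nonneg H (j + 2) η I) fun _ => ∅

/-- The container map of the inductive step (BDTT §5.4, Conditions 16 and 18).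
[cite: BernshteynEtAl2019, §5.4] -/
noncomputable def stepCont (S : StepHyp X H j D η) (P : Fin (j + 1) → Finset α) : Finset α :=
  if Expanding X H (j + 2) D η (P 0) then (pairSel S (P 0)).2 (Fin.tail P)
  else cset X H (j + 2) D η (P 0)

/-- An independent set containing `F` is `G_F`-independent (BDTT Remark 14). [cite: BernshteynEtAl2019, Remark 14] -/
theorem isIndep_gsel {I F : Finset α} (hI : IsIndep H I) (hF : F ⊆ I)
    (h : Expanding X H (j + 2) D η F) : IsIndep (gsel H X j D η F) I :=
  (hI.fiber hF).anti (gsel_spec h).1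

/-- **The inductive step of BDTT Theorem 8** (uniformity `k = j + 2` from `k - 1 = j + 1`), in
multiplicative form: a `(π, σ)`-print/container pair for `H` with fingerprints of size `≤ |X|/D`
and containers missing `≥ η^{3^{k-1}} |X|` points.
[cite: BernshteynEtAl2019, Theorem 8 (inductive step, §5)] -/
theorem step_isContainerPair (S : StepHyp X H j D η) :
    IsContainerPair X H (j + 1) (#X / D) (η ^ (3 ^ (j + 1)) * #X) (stepPrint S) (stepCont S) := by
  have hk : 2 ≤ j + 2 := by omega
  have hΦ := S.phi_nonneg
  -- facts about the maximal fingerprint in the non-expanding case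
  have hcase2 : ∀ I, I ⊆ X → IsIndep H I →
      (¬ ∃ F, F ⊆ I ∧ (#F : ℝ) ≤ #X / D ∧ Expanding X H (j + 2) D η F) →
      let F := fmax S.hD.le hΦ H (j + 2) η I
      F ⊆ I ∧ ¬ Expanding X H (j + 2) D η F ∧ (#F : ℝ) < η * 2⁻¹ ^ (j + 2) * (#X / D) ∧
        ∀ x ∈ I, x ∉ F → x ∈ cset X H (j + 2) D η F := by
    intro I hI hind hno F
    have hFspec := fmax_spec (H := H) (k := j + 2) (η := η) S.hD.le hΦ I
    obtain ⟨hFI, hFΦ, hFexp⟩ := mem_candidates.1 hFspec.1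
    have hnexp : ¬ Expanding X H (j + 2) D η F := fun h => hno ⟨F, hFI, hFΦ, h⟩
    have hsmall : (#F : ℝ) < η * 2⁻¹ ^ (j + 2) * (#X / D) := by
      by_contra hge
      push Not at hge
      exact hnexp (expanding_of_expansive hk S.hD S.hη.le hFexp hge)
    refine ⟨hFI, hnexp, hsmall, fun x hxI hxF => ?_⟩
    by_contra hxC
    have hx : (η * 2⁻¹ ^ (j + 2 + 1)) * (2 * D) ^ (j + 2 - 1) ≤
        (hdeg (hminus H (j + 2) D F) {x} : ℝ) := by
      by_contra hlt
      push Not at hlt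
      exact hxC (mem_cset.2 ⟨hI hxI, hlt⟩)
    have hins := expansive_insert hk S.hH S.hD.le S.hB hFexp hxF hx
    -- `insert x F` is a larger candidate
    have hcard_ins : (#(insert x F) : ℝ) ≤ #X / D := by
      rw [card_insert_of_notMem hxF]
      push_cast
      have hη16 : η * 2⁻¹ ^ (j + 2) ≤ 2⁻¹ := by
        have h1 : η ≤ 1 := S.hη2.trans (pow_le_one₀ (by norm_num) (by norm_num))
        have h2 : (2⁻¹ : ℝ) ^ (j + 2) ≤ 2⁻¹ ^ 1 :=
          pow_le_pow_of_le_one (by norm_num) (by norm_num) (by omega)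
        calc η * 2⁻¹ ^ (j + 2) ≤ 1 * 2⁻¹ ^ 1 :=
              mul_le_mul h1 h2 (by positivity) (by norm_num)
          _ = 2⁻¹ := by norm_num
      have hΦ2 : 2 ≤ #X / D := by
        rw [le_div_iff₀ S.hD]
        calc 2 * D = 2 ^ 1 * D := by norm_num
          _ ≤ 2 ^ (j + 1) * D :=
            mul_le_mul_of_nonneg_right (pow_le_pow_right₀ (by norm_num) (by omega)) S.hD.le
          _ ≤ #X := S.hXD
      have : (#F : ℝ) < 2⁻¹ * (#X / D) :=
        hsmall.trans_le (mul_le_mul_of_nonneg_right hη16 hΦ)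
      linarith
    have hmem : insert x F ∈ candidates H (j + 2) D η (#X / D) I :=
      mem_candidates.2 ⟨insert_subset hxI hFI, hcard_ins, hins⟩
    have := hFspec.2 _ hmem
    rw [card_insert_of_notMem hxF] at this
    exact Nat.lt_irrefl _ this
  refine ⟨?_, ?_, ?_, ?_, ?_⟩
  · -- containers lie in `X`
    intro P
    unfold stepCont
    split_ifs with h
    · exact (pairSel_spec S h).cont_subset _
    · exact cset_subset X H (j + 2) D η (P 0)
  · -- fingerprints are subsets of `I`
    intro I hI hind i
    unfold stepPrint
    split_ifs with h
    · obtain ⟨hFI, -, hFexp⟩ := Classical.choose_spec h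
      refine Fin.cases ?_ (fun i => ?_) i
      · rw [Fin.cons_zero]; exact hFI
      · rw [Fin.cons_succ]
        exact (pairSel_spec S hFexp).print_subset I hI (isIndep_gsel hind hFI hFexp) i
    · refine Fin.cases ?_ (fun i => ?_) i
      · rw [Fin.cons_zero]; exact (hcase2 I hI hind h).1
      · rw [Fin.cons_succ]; exact empty_subset _
  · -- fingerprints are small
    intro I hI hind i
    unfold stepPrint
    split_ifs with h
    · obtain ⟨hFI, hFΦ, hFexp⟩ := Classical.choose_spec h
      refine Fin.cases ?_ (fun i => ?_) i
      · rw [Fin.cons_zero]; exact hFΦ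
      · rw [Fin.cons_succ]
        refine ((pairSel_spec S hFexp).card_print_le I hI (isIndep_gsel hind hFI hFexp) i).trans ?_
        apply div_le_div_of_nonneg_left (Nat.cast_nonneg _) S.hD
        linarith [S.hD]
    · refine Fin.cases ?_ (fun i => ?_) i
      · rw [Fin.cons_zero]; exact (hcase2 I hI hind h).2.2.1.le.trans (by
          have h1 : η * 2⁻¹ ^ (j + 2) ≤ 1 := by
            have := S.hη2
            calc η * 2⁻¹ ^ (j + 2) ≤ 2⁻¹ ^ (2 * (j + 2)) * 1 := by
                  apply mul_le_mul S.hη2 _ (by positivity) (by positivity)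
                  exact pow_le_one₀ (by norm_num) (by norm_num)
              _ ≤ 1 := by
                  rw [mul_one]; exact pow_le_one₀ (by norm_num) (by norm_num)
          simpa using mul_le_mul_of_nonneg_right h1 hΦ)
      · rw [Fin.cons_succ]; simp only [card_empty, Nat.cast_zero]; exact hΦ
  · -- `I` is captured
    intro I hI hind x hxI
    rw [mem_union, mem_biUnion]
    unfold stepCont stepPrint
    split_ifs with h h' h'
    · -- expanding case: the pair of `G_{F₀}` captures `I`
      obtain ⟨hFI, -, hFexp⟩ := Classical.choose_spec h
      have hcap := (pairSel_spec S hFexp).subset_cont I hI (isIndep_gsel hind hFI hFexp) hxI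
      rw [mem_union, mem_biUnion] at hcap
      rcases hcap with ⟨i, -, hi⟩ | hc
      · left
        exact ⟨i.succ, mem_univ _, by rwa [Fin.cons_succ]⟩
      · right
        rwa [Fin.tail_cons]
    · exfalso
      rw [Fin.cons_zero] at h'
      exact h' (Classical.choose_spec h).2.2
    · exfalso
      rw [Fin.cons_zero] at h'
      exact (hcase2 I hI hind h).2.1 h'
    · -- non-expanding case: `x ∈ F` or `x ∈ C(F)`
      by_cases hxF : x ∈ fmax S.hD.le hΦ H (j + 2) η I
      · left
        exact ⟨0, mem_univ _, by rwa [Fin.cons_zero]⟩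
      · right
        rw [Fin.cons_zero]
        exact (hcase2 I hI hind h).2.2.2 x hxI hxF
  · -- containers are small
    intro I hI hind
    unfold stepCont stepPrint
    split_ifs with h h' h'
    · obtain ⟨hFI, -, hFexp⟩ := Classical.choose_spec h
      have hsd := (pairSel_spec S hFexp).le_card_sdiff I hI (isIndep_gsel hind hFI hFexp)
      rw [Fin.tail_cons]
      refine le_trans ?_ hsd
      exact mul_le_mul_of_nonneg_right (pow_three_pow_le j S.hη.le S.hη2) (Nat.cast_nonneg _)
    · exfalso
      rw [Fin.cons_zero] at h'
      exact h' (Classical.choose_spec h).2.2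
    · exfalso
      rw [Fin.cons_zero] at h'
      exact (hcase2 I hI hind h).2.1 h'
    · rw [Fin.cons_zero]
      have hsmall := (hcase2 I hI hind h).2.2.1
      have hsd := le_card_sdiff_cset hk S.hH S.hD S.hη.le S.hB S.hcard
        (fmax S.hD.le hΦ H (j + 2) η I) hsmall.le
      refine le_trans ?_ hsd
      rw [div_mul_eq_mul_div, le_div_iff₀ (by norm_num : (0 : ℝ) < 4)]
      have := pow_three_pow_le_div_four j S.hη.le S.hη2
      nlinarith [Nat.cast_nonneg (α := ℝ) #X]

end Assembly

/-! ### The base case `k = 1` and the theorem -/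

/-- **BDTT Theorem 8, base case `k = 1`**: no fingerprints, container `X ∖ ⋃ H`.
[cite: BernshteynEtAl2019, §5 (base case)] -/
theorem base_isContainerPair (hH : H ⊆ X.powersetCard 1) (hcard : η * #X ≤ #H) :
    IsContainerPair X H 0 (#X / D) (η * #X) (fun _ i => i.elim0) fun _ => X \ H.biUnion id := by
  have hsing : ∀ e ∈ H, ∃ x ∈ X, e = {x} := by
    intro e he
    have h := mem_powersetCard.1 (hH he)
    obtain ⟨x, rfl⟩ := card_eq_one.1 h.2
    exact ⟨x, h.1 (mem_singleton_self x), rfl⟩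
  refine ⟨fun _ => sdiff_subset, fun _ _ _ i => i.elim0, fun _ _ _ i => i.elim0, ?_, ?_⟩
  · intro I hI hind x hxI
    rw [mem_union]
    right
    rw [mem_sdiff]
    refine ⟨hI hxI, fun hx => ?_⟩
    rw [mem_biUnion] at hx
    obtain ⟨e, he, hxe⟩ := hx
    obtain ⟨y, -, rfl⟩ := hsing e he
    rw [id, mem_singleton] at hxe
    subst hxe
    exact hind _ he (singleton_subset_iff.2 hxI)
  · intro I _ _
    have hU : H.biUnion id ⊆ X := by
      intro x hx
      rw [mem_biUnion] at hx
      obtain ⟨e, he, hxe⟩ := hx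
      exact (mem_powersetCard.1 (hH he)).1 hxe
    rw [sdiff_sdiff_right_self, inf_eq_inter, inter_eq_right.2 hU]
    have hdisj : (H : Set (Finset α)).PairwiseDisjoint id := by
      intro e he e' he' hne
      obtain ⟨x, -, rfl⟩ := hsing e he
      obtain ⟨y, -, rfl⟩ := hsing e' he'
      rw [Function.onFun, id, id, disjoint_singleton]
      exact fun h => hne (by rw [h])
    rw [card_biUnion hdisj]
    have : ∑ e ∈ H, #(id e) = #H := by
      rw [card_eq_sum_ones H]
      refine sum_congr rfl fun e he => ?_
      obtain ⟨x, -, rfl⟩ := hsing e he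
      rfl
    rw [this]
    exact hcard

/-- **The hypergraph container theorem (Bernshteyn–Delcourt–Towsner–Tserunyan 2019, Theorem 8;
Balogh–Morris–Samotij 2015 / Saxton–Thomason 2015), multiplicative form.** Let `k ≥ 1`, let `H` be
a family of `k`-subsets of a finite set `X`, `N = |X|`, and let `D > 0`, `0 < η ≤ 2^{-2k}` with
`2^{k-1} D ≤ N`. If `deg_H(u) ≤ D^{k-|u|}` for all `1 ≤ |u| ≤ k-1` (BDTT: `H` is `δ`-bounded,
`D = N^δ`) and `|H| ≥ η N D^{k-1}` (`(δ, ε)`-homogeneous, `η = N^{-ε}`; the side conditions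
`ε ≥ 2k log_N 2`, `π ≥ (k-1) log_N 2` are `η ≤ 2^{-2k}`, `N/D ≥ 2^{k-1}`), then `H` admits a
print/container pair: every `H`-independent `I ⊆ X` has `k - 1` fingerprints `F_i ⊆ I` with
`|F_i| ≤ N/D` (`π = 1 - δ`) and a container `C`, determined by the fingerprints, with
`I ⊆ ⋃ F_i ∪ C` and `|X ∖ C| ≥ η^{3^{k-1}} N` (`σ = 3^{k-1} ε`).
[cite: BernshteynEtAl2019, Theorem 8] -/
theorem container_theorem (X : Finset α) (k : ℕ) (hk : 1 ≤ k) (H : Finset (Finset α)) (D η : ℝ)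
    (hH : H ⊆ X.powersetCard k) (hD : 0 < D) (hη : 0 < η) (hη2 : η ≤ 2⁻¹ ^ (2 * k))
    (hXD : 2 ^ (k - 1) * D ≤ #X) (hB : IsBounded H k D) (hcard : η * #X * D ^ (k - 1) ≤ #H) :
    ∃ (print : Finset α → (Fin (k - 1) → Finset α)) (cont : (Fin (k - 1) → Finset α) → Finset α),
      IsContainerPair X H (k - 1) (#X / D) (η ^ (3 ^ (k - 1)) * #X) print cont := by
  obtain ⟨m, rfl⟩ : ∃ m, k = m + 1 := ⟨k - 1, by omega⟩
  simp only [Nat.add_sub_cancel] at hXD hcard ⊢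
  induction m generalizing H D η with
  | zero =>
    refine ⟨fun _ i => i.elim0, fun _ => X \ H.biUnion id, ?_⟩
    simp only [pow_zero, pow_one, mul_one] at hcard ⊢
    exact base_isContainerPair hH hcard
  | succ m ih =>
    have S : StepHyp X H m D η :=
      { hH := hH
        hD := hD
        hη := hη
        hη2 := hη2
        hXD := hXD
        hB := hB
        hcard := hcard
        IH := fun G hG hGB hGcard => by
          have hη' : 0 < η ^ 2 * 2⁻¹ ^ (2 * (m + 2)) := by positivity
          have hη'2 : η ^ 2 * 2⁻¹ ^ (2 * (m + 2)) ≤ 2⁻¹ ^ (2 * (m + 1)) := by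
            have h1 : η ^ 2 ≤ 1 := by
              have : η ≤ 1 := hη2.trans (pow_le_one₀ (by norm_num) (by norm_num))
              exact pow_le_one₀ hη.le this
            calc η ^ 2 * 2⁻¹ ^ (2 * (m + 2)) ≤ 1 * 2⁻¹ ^ (2 * (m + 1)) := by
                  apply mul_le_mul h1 _ (by positivity) zero_le_one
                  exact pow_le_pow_of_le_one (by norm_num) (by norm_num) (by omega)
              _ = 2⁻¹ ^ (2 * (m + 1)) := one_mul _
          have hXD' : 2 ^ m * (2 * D) ≤ #X := by
            rw [← mul_assoc, ← pow_succ]; exact hXD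
          exact ih G (2 * D) (η ^ 2 * 2⁻¹ ^ (2 * (m + 2))) (hH := hG) (hD := by positivity)
            (hη := hη') (hη2 := hη'2) (hXD := hXD') (hB := hGB) (hcard := hGcard) (hk := by omega) }
    exact ⟨stepPrint S, stepCont S, step_isContainerPair S⟩

end Step

end Literature.Combinatorics.Hypergraph
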